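import Mathlib

/-!
# A2Primitive — the first sentence of Lemma A4.2.1 (and of Prop. A8.1 Step 1)

route/T4-A2-p6.md, Lemma A4.2.1: «Let `a_0 ∈ O_F` be a primitive element (`F = ℚ(a_0)`; it exists:
multiply a primitive element by a positive integer) … The six numbers `τ(a_0)`, `τ ∈ Σ`, are pairwise
distinct (two embeddings agreeing on a generator of `F` coincide).»

Kernel-checked here (cell pub-hodge-repro2, Tier 4, sub-claim A2):
* `algHom_ext_of_adjoin_eq_top`: two `ℚ`-algebra homomorphisms `F → L` agreeing on a generator `a`
  (`Algebra.adjoin ℚ {a} = ⊤`) are equal; hence `embedding_eval_injective`: `σ ↦ σ(a)` is injective on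
  the embeddings — this is the hypothesis `hr` of `A2Separation.exists_separation_le_card` /
  `exists_le_42` / `exists_le_120` with `r_σ := σ(a_0)`;
* `adjoin_natCast_mul_eq_top`: a non-zero integer multiple of a generator is again a generator;
* `exists_natCast_mul_isIntegral_adjoin_eq_top`: an algebraic generator has an integral (over `ℤ`)
  positive integer multiple which is again a generator — the parenthesis «it exists».
The primitive element theorem itself (a generator exists for `F/ℚ` finite separable) is Mathlib's
`Field.exists_primitive_element`, restated in `exists_generator` for a finite extension of `ℚ`.
-/

namespace Summit.Ventures.HodgeRepro2.A2Primitive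

/-- Two `ℚ`-algebra homomorphisms out of `F` that agree on a generator `a` of `F`
(`Algebra.adjoin ℚ {a} = ⊤`) coincide. -/
theorem algHom_ext_of_adjoin_eq_top {F L : Type*} [CommRing F] [CommRing L] [Algebra ℚ F]
    [Algebra ℚ L] {a : F} (ha : Algebra.adjoin ℚ {a} = ⊤) {σ σ' : F →ₐ[ℚ] L} (h : σ a = σ' a) :
    σ = σ' := by
  have hEq : Set.EqOn σ σ' (Algebra.adjoin ℚ {a} : Set F) :=
    (AlgHom.eqOn_adjoin_iff).2 (fun x hx => by rw [Set.mem_singleton_iff.1 hx]; exact h)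
  rw [ha] at hEq
  exact AlgHom.ext fun x => hEq (Algebra.mem_top)

/-- «The numbers `τ(a_0)`, `τ ∈ Σ`, are pairwise distinct»: for a generator `a` of `F`, evaluation at `a`
is injective on the `ℚ`-embeddings `F → L`. This is the injectivity hypothesis of the quantitative
separation (`A2Separation.exists_separation_le_card` with `r σ := σ a`). -/
theorem embedding_eval_injective {F L : Type*} [CommRing F] [CommRing L] [Algebra ℚ F]
    [Algebra ℚ L] {a : F} (ha : Algebra.adjoin ℚ {a} = ⊤) :
    Function.Injective (fun σ : F →ₐ[ℚ] L => σ a) :=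
  fun _ _ h => algHom_ext_of_adjoin_eq_top ha h

/-- A non-zero integer multiple of a generator of `F` is again a generator. -/
theorem adjoin_natCast_mul_eq_top {F : Type*} [Field F] [Algebra ℚ F] [CharZero F] {a : F}
    (ha : Algebra.adjoin ℚ {a} = ⊤) {n : ℕ} (hn : n ≠ 0) :
    Algebra.adjoin ℚ {(n : F) * a} = ⊤ := by
  apply top_le_iff.1
  rw [← ha]
  apply Algebra.adjoin_le
  intro x hx
  rw [Set.mem_singleton_iff] at hx
  subst hx
  have hmem : (n : F) * x ∈ Algebra.adjoin ℚ {(n : F) * x} :=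
    Algebra.subset_adjoin (Set.mem_singleton _)
  have hsmul := Subalgebra.smul_mem _ hmem ((n : ℚ)⁻¹)
  have hn' : (n : F) ≠ 0 := Nat.cast_ne_zero.2 hn
  have hcalc : ((n : ℚ)⁻¹ • ((n : F) * x)) = x := by
    rw [Algebra.smul_def, map_inv₀, map_natCast, ← mul_assoc, inv_mul_cancel₀ hn', one_mul]
  rw [hcalc] at hsmul
  exact hsmul

/-- «It exists: multiply a primitive element by a positive integer»: an algebraic generator `a` of `F`
has a positive integer multiple `n • a` which is integral over `ℤ` and still generates `F`. -/
theorem exists_natCast_mul_isIntegral_adjoin_eq_top {F : Type*} [Field F] [Algebra ℚ F]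
    [CharZero F] {a : F} (ha : Algebra.adjoin ℚ {a} = ⊤) (halg : IsAlgebraic ℚ a) :
    ∃ n : ℕ, n ≠ 0 ∧ IsIntegral ℤ ((n : F) * a) ∧ Algebra.adjoin ℚ {(n : F) * a} = ⊤ := by
  have halgZ : IsAlgebraic ℤ a := (IsFractionRing.isAlgebraic_iff ℤ ℚ F).2 halg
  obtain ⟨y, hy0, hy⟩ := halgZ.exists_integral_multiple
  have hn : y.natAbs ≠ 0 := Int.natAbs_ne_zero.2 hy0
  refine ⟨y.natAbs, hn, ?_, adjoin_natCast_mul_eq_top ha hn⟩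
  have hint : IsIntegral ℤ (y.natAbs • a) := by
    rcases Int.natAbs_eq y with h | h
    · rw [h, natCast_zsmul] at hy
      exact hy
    · rw [h, neg_zsmul, natCast_zsmul] at hy
      simpa using hy.neg
  rw [← nsmul_eq_mul]
  exact hint

/-- The primitive element theorem for a finite extension of `ℚ`, in the `Algebra.adjoin` form used
above (Mathlib's `Field.exists_primitive_element`; separability is automatic in characteristic `0`,
and `ℚ⟮α⟯ = ℚ[α]` because `α` is algebraic). -/
theorem exists_generator (F : Type*) [Field F] [Algebra ℚ F] [FiniteDimensional ℚ F] :
    ∃ a : F, Algebra.adjoin ℚ {a} = ⊤ := by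
  obtain ⟨α, hα⟩ := Field.exists_primitive_element ℚ F
  refine ⟨α, ?_⟩
  have hint : IsIntegral ℚ α := IsIntegral.of_finite ℚ α
  have h1 := IntermediateField.adjoin_simple_toSubalgebra_of_isAlgebraic hint.isAlgebraic
  rw [hα, IntermediateField.top_toSubalgebra] at h1
  exact h1.symm

end Summit.Ventures.HodgeRepro2.A2Primitive
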